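import Mathlib
import HarnessLib
import HarnessLib.Audit
import Summits.MatrixMultiplication.Statement
import Literature.Computability.AlgebraicComplexity.GroupTheoreticMatMul
import Literature.Computability.AlgebraicComplexity.FlatteningBound

/-!
Route: ConeDesigns

CLOSED (refuted) 2026-08-17T05:41:16Z by planner-rfix-MatrixMultiplication-ConeDesign-8f89c9fa-0 — reason: refuted:stmt-MatrixMultiplication-9759 (ConeDesignThesis) by Summit.MatrixMultiplication.MatrixMultiplication.Theorems.ConeDesignsConeDesignThesis_refuted — note: route-repair census (planner-rfix-…-8f89c9fa-0, 2026-08-17). KILL CRITERION MET — the route header pre-registered "ConeBarrier proved (all ranks) ⇒ X false: close refuted:ConeDesignThesis, record the bounded-rank barrier as catalogue candidate"; both have happened. (1) ConeDesignThesis (stmt-9759, t. The file is kept as the record of this route; refuted decls are indexed as negative knowledge (`ledger negatives`).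

# Route ConeDesigns — cone STPP designs at bounded rank — packing-tight triangle systems in
PG(n-1,q) give omega = 2, or a bounded-rank barrier

X = ConeDesignThesis (realises card cone-designs-bounded-rank-rev, its positive twin): there is a
FIXED rank n such that for every
θ > 0 and infinitely many primes q the group H = (ZMod q)^n carries a CONE STPP design — N labelled
triangles (a_i, b_i, c_i) of
nonzero vectors whose punctured lines A_i = F_q^× a_i, B_i = F_q^× b_i, C_i = F_q^× c_i satisfy the
simultaneous triple product
property `IsSTPP` (CohnKleinbergSzegedyUmans2005 Def 5.1, tree) — with N ≥ q^(n−2−θ) triangles, i.e.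
the packing bound
N ≤ q^n/(q−1)² is met up to q^o(1) at that rank. It suffices: each design certifies N·(q−1)^ω ≤ q^n
by the PROVED abelian
fundamental inequality (CKSU Thm 5.5, `CohnKleinbergSzegedyUmans2005_5_5_abelian_holds`), so (q−1)^ω
≤ q^(2+θ) along q → ∞ gives
ω ≤ 2 + θ for every θ, and ω ≥ 2 is the proved flattening bound (`omega_two_le`). The route is a
dichotomy test: its rank-2 crux
ConeBarrier is ¬X in effective form (the bounded-rank companion of the bounded-exponent barrier),
flanked by the first open rank
(RankFourBounded) and the first generic rank (RankSixSuperlinear).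
Lean: `∃ n : ℕ, ∀ θ : ℝ, 0 < θ → ∀ q₀ : ℕ, ∃ q : ℕ, q₀ ≤ q ∧ ∃ (_ : Fact q.Prime) (N : ℕ) (a b c :
Fin N → Fin n → ZMod q), (∀ i, a i ≠ 0 ∧ b i ≠ 0 ∧ c i ≠ 0) ∧
Literature.Computability.AlgebraicComplexity.IsSTPP (fun i => ((Finset.univ : Finset (ZMod q)).image
(fun t => t • a i)).erase 0) (fun i => ((Finset.univ : Finset (ZMod q)).image (fun t => t • b
i)).erase 0) (fun i => ((Finset.univ : Finset (ZMod q)).image (fun t => t • c i)).erase 0) ∧ (q : ℝ)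
^ ((n : ℝ) - 2 - θ) ≤ (N : ℝ)`

## Assembly
Pure logic over two proved Literature theorems (sorry-free `closes` in the planner's Sketch.lean,
axioms propext/choice/Quot.sound):
rewrite the summit as ω(ℂ) = 2 (`MatrixMultiplication_iff`); ω ≥ 2 is
`Literature.Computability.AlgebraicComplexity.omega_two_le ℂ`;
for ω ≤ 2 use `le_of_forall_pos_le_add`: given θ > 0, X supplies the rank n and, for each q₀, a
prime q ≥ q₀ with a design of
N ≥ q^(n−2−θ) triangles, ConeCertificate turns it into N·(q−1)^ω ≤ q^n, and ConesBoundOmega (w :=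
ω(ℂ)) returns ω ≤ 2 + θ.

Rationale: WHY THIS LINE. Mechanism (card cone-designs-bounded-rank-rev): restrict the abelian STPP programme
(CohnKleinbergSzegedyUmans2005 §5; route GroupTheoreticSTPP,
whose target CThesis contains X as the scalar-invariant bounded-rank special case) to the one regime
with neither a barrier nor a candidate —
rank n fixed, q → ∞ prime, so H has unbounded exponent and
BlasiakChurchCohnGrochowNaslundSawinUmans2017 Thm A/B cost only a constant factor
(0.84..)^n, no power of q — and to F_q^×-invariant sets, where STPP becomes pure projective
geometry: by the exact criterion (support
ConeCriterion) a cone family is STPP iff every triangle is linearly independent and no labelled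
hexagon [a_i, a_k, b_j, b_i, c_k, c_j]
((i,j,k) not all equal) has a nowhere-zero linear dependency, while packing makes the three
edge-classes near line-spreads of PG(n−1,q).
Imported area: finite geometry / coding theory (arcs and normal rational curves — Ball2012
doi:10.4171/jems/316 —, spreads and linear sets
arXiv:1310.8522, finite-field incidence bounds Vinh2011 doi:10.1016/j.ejc.2011.06.008) instead of
slice rank or Fourier analysis, which
scalar invariance disables (violation coefficients range over all of F_q^×). What is new relative to
prior routes: GroupTheoreticSTPP asks for
packing-bound STPP families in SOME abelian group (CPackingConstruction = CKSU Conj 4.7, no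
candidate); AutomaticSTPPDesigns is the opposite
corner (q fixed, rank → ∞); here the extremal function N(n,q) is a concrete projective quantity with
proved endpoints — N(3,q) = 2 (card Thm 2,
support RankThreeAtMostTwo), N(6,q) ≥ ⌊q/3⌋ from the normal rational curve (planner's observation,
support RankSixMomentCurve),
N(m+n,q) ≥ N(m,q)·N(n,q) by CKSU Lemma 5.4 with diagonal sub-cones, random alteration q^((n−5)/2) —
against the target q^(n−2). Negatives index: empty.

RANKED CRUXES. #0 ConeDesignThesis (target) — X as in § Thesis: some fixed rank n admits, for every
θ > 0 and infinitely many primes q, a cone STPP design in (ZMod q)^n with N ≥ q^(n−2−θ) triangles of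
nonzero vectors. (why it might fail: needs κ(n) = n−2 exactly: three matched near-line-spreads of
PG(n−1,q) threading ≈ q^(3n−6) hexagons; random alteration gives q^((n−5)/2), moment curve +
products q^(n/6), rank 3 is rigid (N ≡ 2); no packing-tight STPP family is known in any group
(arXiv:2204.03826 p. 3).) [CohnKleinbergSzegedyUmans2005,
BlasiakChurchCohnGrochowNaslundSawinUmans2017, BlasiakCohnGrochowPrattUmans2023, arXiv:math/0511460]
#2 ConeBarrier (crux) — BOUNDED-RANK BARRIER (card K1; ¬X in effective form): for every rank n there
are η > 0 and q₀ such that for all primes q ≥ q₀ every cone STPP design of nonzero vectors in (ZMod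
q)^n has N ≤ q^(n−2−η) triangles — a power saving over the packing bound at each fixed rank. Proving
it closes the route `refuted:ConeDesignThesis` and is a candidate catalogue barrier
(scalar-invariant designs, bounded rank); refuting it at one rank proves X. [difficulty:
open-problem] (why it might fail: X may hold: for n ≥ 6 the hexagon condition is Zariski-open and a
linear-set / Singer-orbit family invisible to Lang–Weil counting could thread all hexagons at N =
q^(n−2−o(1)); no upper-bound tool beyond packing (slice rank saves only a constant at fixed rank) is
known here.) [BlasiakChurchCohnGrochowNaslundSawinUmans2017, CohnKleinbergSzegedyUmans2005,
Vinh2011, doi:10.1016/j.ejc.2011.06.008, arXiv:1310.8522]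
#3 RankFourBounded (crux) — FIRST OPEN RANK (card K2 at n = 4): there is an absolute constant M such
that for every prime q every cone STPP design of nonzero vectors in (ZMod q)^4 has at most M
triangles (N(4,q) = O(1); in PG(3,q) every 5 of the 6 points of an STPP hexagon contain 4 coplanar
points off the fifth, and the three edge-classes are partial line spreads). [difficulty: L] (why it
might fail: rank-4 STPP pairs are not rigid (65,568 normalised pairs extend a fixed frame at q = 7,
card data) and a slowly growing family N(4,q) → ∞ (even N ≈ log q) cannot be excluded by
enumeration; note N(4,q) ≥ q+4 for large q would already certify ω < 3.)
[CohnKleinbergSzegedyUmans2005, arXiv:math/0511460, BlasiakChurchCohnGrochowNaslundSawinUmans2017]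
#4 RankSixSuperlinear (crux) — FIRST GENERIC RANK, POSITIVE PROBE (card K3, recalibrated): for some
δ > 0 and infinitely many primes q there is a cone STPP design of nonzero vectors in (ZMod q)^6 with
N ≥ q^(1+δ) triangles — beating both random alteration (q^(1/2)) and the normal rational curve
(⌊(q+1)/3⌋, support RankSixMomentCurve), hence the first design whose dependent 6-subsets
systematically dodge the labelled hexagons. [difficulty: L] (why it might fail: κ(6) = 1 is
possible: 6-wise independent point sets of PG(5,q) are arcs of size ≤ q+1 (Ball2012, q prime),
subfield/linear-set matchings of F_q^6 = F_(q^2)^3, F_(q^3)^2 collapse to N ≤ q+1 (card), and a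
random family of N ≫ q^(1/2) triangles has ≈ N³/q bad hexagons.) [Ball2012, doi:10.4171/jems/316,
arXiv:1310.8522, arXiv:1904.05813, CohnKleinbergSzegedyUmans2005]
#9 ConeCertificate (support) — CERTIFIED EXPONENT: for every prime q, rank n and cone STPP design of
N triangles of nonzero vectors in (ZMod q)^n, N·(q−1)^ω(ℂ) ≤ q^n — the proved abelian fundamental
inequality `CohnKleinbergSzegedyUmans2005_5_5_abelian_holds` applied to H = Fin n → ZMod q, each
punctured line having exactly q−1 elements. [difficulty: provable-now]
[CohnKleinbergSzegedyUmans2005,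
lean:Literature.Computability.AlgebraicComplexity.CohnKleinbergSzegedyUmans2005_5_5_abelian_holds]
#9 ConesBoundOmega (support) — PURE ANALYSIS GLUE: if for some θ > 0 there are arbitrarily large q
with naturals n, N satisfying N·(q−1)^w ≤ q^n and q^(n−2−θ) ≤ N, then w ≤ 2+θ (otherwise
(1−1/q)^w·q^(w−2−θ) → ∞). [difficulty: provable-now] [Blaser2013, CohnKleinbergSzegedyUmans2005]
#9 ConeCriterion (support) — EXACT CRITERION (card P1): for a prime q ≥ 3 and nonzero vectors, the
cone family is STPP iff (i) every triangle (a_i, b_i, c_i) is linearly independent and (ii) for all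
(i,j,k) not all equal no nowhere-zero λ ∈ F_q^6 has λ₀a_i + λ₁a_k + λ₂b_j + λ₃b_i + λ₄c_k + λ₅c_j =
0 (substitute s' = λ₀a_i, s = −λ₁a_k, …; q ≥ 3 is needed only for STPP ⇒ (i)). [difficulty:
provable-now] [CohnKleinbergSzegedyUmans2005, BlasiakChurchCohnGrochowNaslundSawinUmans2017]
#9 RankThreeAtMostTwo (support) — RANK THREE IS CKSU'S EXAMPLE (card Theorems 1–2): for every prime
q ≥ 7 a cone STPP design of nonzero vectors in (ZMod q)^3 has at most 2 triangles (an STPP pair is a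
triangle and one of its two cyclic relabellings; the triple Δ, ρΔ, ρ²Δ fails hexagon (0,1,2)); CKSU
Prop 5.2 shows 2 is attained. [difficulty: M] [CohnKleinbergSzegedyUmans2005, arXiv:math/0511460]
#9 RankSixMomentCurve (support) — MOMENT-CURVE BASELINE (planner's observation): for every prime q
and N with 3N ≤ q there is a cone STPP design with N triangles in (ZMod q)^6 — take 3N distinct
points (1,t,…,t^5) of the normal rational curve, any ≤ 6 of which are linearly independent
(Vandermonde), and label them arbitrarily; grouping the STPP equation by distinct vectors forces i =
j = k. With CKSU Lemma 5.4 (diagonal sub-cones of products) this gives N(6k,q) ≥ ⌊q/3⌋^k.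
[difficulty: provable-now] [Ball2012, CohnKleinbergSzegedyUmans2005]

TWO-LAYER PLAN. Foreseen glued splits (k ≤ 3, depth 1), filed only when a crux closes or stalls with
a census: ConeBarrier ⇐ LowRankBarrier (n ≤ 5:
every hexagon is in special position, incidence counting) → GenericRankBarrier (n ≥ 6: beat the |H|²
overcount of accidental
degeneracies) → ConeBarrier; RankFourBounded ⇐ PairClassification (STPP pairs of PG(3,q) via the
three partial spreads and the
4-coplanar rule) → BoundedExtension → RankFourBounded; RankSixSuperlinear ⇐ an explicit algebraic
family (curves of higher degree /
norm-trace or Hermitian point sets with controlled dependent 6-sets) → its hexagon audit →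
RankSixSuperlinear. X itself, if ConeBarrier
dies at some rank n₀, splits as SpreadTriangulation(n₀) → HexagonThreading(n₀) → X.

KILL CRITERIA. ConeBarrier proved (all ranks) ⇒ X is false: close `refuted:ConeDesignThesis`, record
the bounded-rank barrier for scalar-invariant designs
as a catalogue candidate next to TricoloredSumFreeBarrier, and hand the cone class back to card
algebraic-stpp-dimension-dichotomy as settled.
RankSixSuperlinear refuted (N(6,q) = O(q)) together with RankFourBounded proved ⇒ pivot: the route
shrinks to the barrier line (re-rank
ConeBarrier's generic-rank child first). A proof of GroupTheoreticSTPP's CAbelianObstructionNeg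
(uniform ε for all abelian groups) refutes X
outright; a proof of CThesis elsewhere moots the positive side but not the barrier cruxes.

NOT DECOMPOSED YET. Rank 5 (conjecturally N(5,q) = O(1) like rank 4 — every hexagon of 6 vectors in
F_q^5 is dependent); the uniform barrier
κ(n) ≤ (1−c)(n−2) (needs c ≤ 1/2 by random alteration; not filed — the per-rank form is the honest
¬X); prime powers q and
non-prime cyclic factors (CKSU's example lives in Cyc_m^3 for every m); multi-line cones (unions of
punctured lines per colour class);
the exact values N(4,7), N(6,q) for q ≤ 13 (kit SAT/ILP on ConeCriterion) — layer-2 material or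
evidence files, not items.

CHEAPEST FALSIFIER. Run the exact criterion (ConeCriterion) through SAT/ILP for (n,q) ∈
{(4,7),(4,11),(4,13),(6,7),(6,11),(6,13)}: N(4,q) growing with q
kills RankFourBounded; N(6,q) ≤ c·q with visible rigidity supports κ(6) = 1 against
RankSixSuperlinear; conversely any structured
family with N(6,q) ≥ q^1.2 at q ≤ 13 would be the first superlinear design. Not run here
(compute-free hub, planner seat); the
card's data: N(3,7) = 2 (exhaustive), N(4,7) ≥ 3, greedy 7 at (6,7) (vs ⌊8/3⌋ = 2 from the rational
normal curve at q = 7).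

NUMBERS. Packing: N(n,q) ≤ q^n/(q−1)² (BCCGNSU Lemma 2.4, tree `IsSTPP.packing`). Certified exponent
ω ≤ (n·log q − log N)/log(q−1): CKSU's
rank-3 pair gives ω < 2.82 (m = 17); N = q^(n−2−θ) gives ω ≤ 2 + θ + O(1/log q); ω < 3 needs N >
q^n/(q−1)³ ≈ q^(n−3) (rank 4: N ≥ q+4).
Rank 4 remark (planner, unverified in detail): if the three edge classes were genuine partial line
spreads of PG(3,q), generic hexagons alone
(two of the three edges ab_i, bc_j, ca_k must be coplanar; a line meets ≤ q+1 lines of a partial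
spread) force N(4,q) ≤ 3q+5 — shared labelled
vertices are allowed by packing and not yet handled. Lower bounds: random alteration N ≳ q^((n−5)/2)
(n ≥ 6; expected bad hexagons N³q^(5−n)); normal rational curve N(n,q) ≥ ⌊(q+1)/3⌋
for n ≥ 6; products N(m+n,q) ≥ N(m,q)N(n,q) (CKSU Lemma 5.4 + diagonal sub-cones). Endpoints: N(n,q)
= 0 for n ≤ 2, N(3,q) = 2
(q ≥ 7, card Thm 2). Slice rank at fixed n: constant factor ≈ 3·(0.85)^n only (BCCGNSU Thm 4.14).
Items at open: 10 (3 cruxes).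

DEFINITION REQUESTS. None filed: punctured lines are inlined as `((Finset.univ : Finset (ZMod
q)).image (fun t => t • a i)).erase 0` over
`Literature.Computability.AlgebraicComplexity.IsSTPP`; a named `coneFamily` / extremal function
`N(n,q)` in
Literature/Computability/AlgebraicComplexity would be cosmetic and can be requested by the first
prover who wants it.

Novelty: Searches (2026-08-15): `lit frontier MatrixMultiplication --since 2021` (30 rows; none on STPP
designs in F_q^n at bounded rank);
`lit bridges MatrixMultiplication --cross any` (30 rows, textbooks/surveys only); `lit search
--source arxiv "simultaneous triple product
property matrix multiplication"` (1: arXiv:cs/0703145, Murthy 2007, search/survey); `lit search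
--source zbmath "triple product property
matrix multiplication group-theoretic"` (5: arXiv:2410.14905, 1305.0448, 1107.5973, 1104.5097,
1107.5969 — non-abelian TPP searches);
`lit search --source zbmath "simultaneous triple product property projective space lines"` (0); `lit
search --source arxiv "strong uniquely
solvable puzzle search"` (2: arXiv:2301.00074, 2307.06463 — fixed q, growing width); `lit galaxy
search "simultaneous triple product
property" --star all` (5: Landsberg's book, CKSU05, Sawin arXiv:1702.00905, Stothers' thesis ×2);
`lit galaxy search "triple product
property" --star pdf` (6, adds ITCS 2025 arXiv:2410.14905); `lit search --source arxiv
"group-theoretic matrix multiplication Reed-Solomon triple product property"` (0), `--source zbmath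
"triple
product property abelian group punctured"` (0), `--source s2 "uniquely solvable puzzles matrix
multiplication …" --year-from 2018` (1: arXiv:2307.06463);
crossref lookups for Ball2012 and Vinh2011; lean search of the tree
(IsSTPP, CKSU 5.5 proved, 42 route files grepped for cone/coloop/spread: none).
Nearest prior art found: CohnKleinbergSzegedyUmans2005 (ar  [refs: cs/0703145, 2410.14905, 2301.00074, 1702.00905, 2307.06463, math/0511460, 1605.06702, Ball2012, Vinh2011, CohnKleinbergSzegedyUmans2005, BlasiakChurchCohnGrochowNaslundSawinUmans2017]

Barriers (technique_class: group-theoretic-approach, abelian-STPP, cone-designs): - technique_class: group-theoretic-approach, abelian-STPP, cone-designs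
- Literature.Barriers.MatrixMultiplication.TricoloredSumFreeBarrier: evaded by hypothesis and
quantitatively: H = (ZMod q)^n with q → ∞ prime has exponent q → ∞, outside Thm B's bounded-exponent
scope (`not_beats_of_exponent_le` gives ε_ℓ per exponent ℓ only); at fixed rank the slice-rank bound
Thm 4.14 saves a constant factor ≈ 3·(0.85)^n on N and no power of q, so it cannot separate
q^(n−2−θ) from q^(n−2); ConeBarrier is precisely the missing bounded-rank companion and needs a new
(projective) tool.
- Literature.Barriers.MatrixMultiplication.EquivoluminousBarrier: does not bite — no CW §11-type
local hypothesis is used; the designs are explicit point sets at fixed rank, not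
coordinate-symmetric families with |S| → ∞.
- Literature.Barriers.MatrixMultiplication.NilpotentGroupBarrier: n/a — H is abelian; its slice-rank
content for abelian p-groups is the TricoloredSumFree line above.
- Literature.Barriers.MatrixMultiplication.NormalizerBarrier: n/a — concerns subgroup TPP triples
with large normalisers in non-abelian groups; here the sets are punctured lines in an abelian group
and the packing role is played by the near-spread lemma.
- Literature.Barriers.MatrixMultiplication.QuasirandomBarrier: n/a — needs a large second character
degree; all character degrees of H are 1.
- Literature.Barriers.MatrixMultiplication.YoungSubgroupBarrier: n/a — no symmetric groups.
- Literature.Barriers.MatrixMultiplication.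

History (route lifecycle, newest last):
- 2026-08-16T04:10:35Z · AUTO-CRUX (backfill): ConeDesignThesis — hypotheses of the deciding theorem that nothing in the route derives are cruxes (operator:999:1085951)
- 2026-08-17T05:18:58Z · BROKEN — ConeDesignThesis (stmt-MatrixMultiplication-9759, crux) refuted by Summit.MatrixMultiplication.MatrixMultiplication.Theorems.ConeDesignsConeDesignThesis_refuted @ 72a1d22e31b5 (refuter-rattack-stmt-MatrixMultiplication-9759-0)
- 2026-08-17T05:41:17Z · CLOSED refuted — refuted:stmt-MatrixMultiplication-9759 (ConeDesignThesis) by Summit.MatrixMultiplication.MatrixMultiplication.Theorems.ConeDesignsConeDesignThesis_refuted (planner-rfix-MatrixMultiplication-ConeDesign-8f89c9fa-0)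

sub-problem: MatrixMultiplication · status: closed(refuted) · opened planner-plancard-MatrixMultiplication-MatrixM-53b1192e-0 2026-08-15T14:23:03Z · rev 1 · ledger route-MatrixMultiplication-ConeDesigns
GENERATED by the gate from the ledger (D-0016/17). Provers cite these decls: `theorem foo : Summit.MatrixMultiplication.MatrixMultiplication.Theses.ConeDesigns.<Decl> := …` in Summits/MatrixMultiplication/MatrixMultiplication/Theorems/<Name>.lean.
-/

namespace Summit.MatrixMultiplication.MatrixMultiplication.Theses.ConeDesigns

open scoped BigOperators Topology Manifold Classical MeasureTheory ProbabilityTheory Matrix InnerProductSpace ComplexConjugate ContinuousMap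
open Filter Set Function TopologicalSpace MeasureTheory

attribute [summit_statement] _root_.MatrixMultiplication

/-- item stmt-MatrixMultiplication-9759 · crux (kind.auto-crux: conjecture-grade) · rank 0 · closed · refuted by Summit.MatrixMultiplication.MatrixMultiplication.Theorems.ConeDesignsConeDesignThesis_refuted @ 72a1d22e31b5 (refuter) · by planner
why it might fail: needs κ(n) = n−2 exactly: three matched near-line-spreads of PG(n−1,q) threading ≈ q^(3n−6) hexagons; random alteration gives q^((n−5)/2), moment curve + products q^(n/6), rank 3 is rigid (N ≡ 2); no packing-tight STPP family is known in any group (arXiv:2204.03826 p. 3).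
sources: CohnKleinbergSzegedyUmans2005, BlasiakChurchCohnGrochowNaslundSawinUmans2017, BlasiakCohnGrochowPrattUmans2023, arXiv:math/0511460
[target] X as in § Thesis: some fixed rank n admits, for every θ > 0 and infinitely many primes q, a
cone STPP design in (ZMod q)^n with N ≥ q^(n−2−θ) triangles of nonzero vectors. -/
@[route_item "route-MatrixMultiplication-ConeDesigns"]
def ConeDesignThesis : Prop :=
  ∃ n : ℕ, ∀ θ : ℝ, 0 < θ → ∀ q₀ : ℕ, ∃ q : ℕ, q₀ ≤ q ∧ ∃ (_ : Fact q.Prime) (N : ℕ) (a b c : Fin N → Fin n → ZMod q), (∀ i, a i ≠ 0 ∧ b i ≠ 0 ∧ c i ≠ 0) ∧ Literature.Computability.AlgebraicComplexity.IsSTPP (fun i => ((Finset.univ : Finset (ZMod q)).image (fun t => t • a i)).erase 0) (fun i => ((Finset.univ : Finset (ZMod q)).image (fun t => t • b i)).erase 0) (fun i => ((Finset.univ : Finset (ZMod q)).image (fun t => t • c i)).erase 0) ∧ (q : ℝ) ^ ((n : ℝ) - 2 - θ) ≤ (N : ℝ)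

/-- item stmt-MatrixMultiplication-9760 · crux · rank 2 · closed · moot by None · by planner
why it might fail: X may hold: for n ≥ 6 the hexagon condition is Zariski-open and a linear-set / Singer-orbit family invisible to Lang–Weil counting could thread all hexagons at N = q^(n−2−o(1)); no upper-bound tool beyond packing (slice rank saves only a constant at fixed rank) is known here.
sources: BlasiakChurchCohnGrochowNaslundSawinUmans2017, CohnKleinbergSzegedyUmans2005, Vinh2011, doi:10.1016/j.ejc.2011.06.008, arXiv:1310.8522
[crux] BOUNDED-RANK BARRIER (card K1; ¬X in effective form): for every rank n there are η > 0 and q₀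
such that for all primes q ≥ q₀ every cone STPP design of nonzero vectors in (ZMod q)^n has N ≤
q^(n−2−η) triangles — a power saving over the packing bound at each fixed rank. Proving it closes
the route `refuted:ConeDesignThesis` and is a candidate catalogue barrier (scalar-invariant designs,
bounded rank); refuting it at one rank proves X. [difficulty: open-problem] -/
@[route_item "route-MatrixMultiplication-ConeDesigns"]
def ConeBarrier : Prop :=
  ∀ n : ℕ, ∃ η : ℝ, 0 < η ∧ ∃ q₀ : ℕ, ∀ (q : ℕ) [Fact q.Prime], q₀ ≤ q → ∀ (N : ℕ) (a b c : Fin N → Fin n → ZMod q), (∀ i, a i ≠ 0 ∧ b i ≠ 0 ∧ c i ≠ 0) → Literature.Computability.AlgebraicComplexity.IsSTPP (fun i => ((Finset.univ : Finset (ZMod q)).image (fun t => t • a i)).erase 0) (fun i => ((Finset.univ : Finset (ZMod q)).image (fun t => t • b i)).erase 0) (fun i => ((Finset.univ : Finset (ZMod q)).image (fun t => t • c i)).erase 0) → (N : ℝ) ≤ (q : ℝ) ^ ((n : ℝ) - 2 - η)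

/-- item stmt-MatrixMultiplication-9761 · crux · rank 3 · closed · moot by None · by planner
why it might fail: rank-4 STPP pairs are not rigid (65,568 normalised pairs extend a fixed frame at q = 7, card data) and a slowly growing family N(4,q) → ∞ (even N ≈ log q) cannot be excluded by enumeration; note N(4,q) ≥ q+4 for large q would already certify ω < 3.
sources: CohnKleinbergSzegedyUmans2005, arXiv:math/0511460, BlasiakChurchCohnGrochowNaslundSawinUmans2017
[crux] FIRST OPEN RANK (card K2 at n = 4): there is an absolute constant M such that for every prime
q every cone STPP design of nonzero vectors in (ZMod q)^4 has at most M triangles (N(4,q) = O(1); in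
PG(3,q) every 5 of the 6 points of an STPP hexagon contain 4 coplanar points off the fifth, and the
three edge-classes are partial line spreads). [difficulty: L] -/
@[route_item "route-MatrixMultiplication-ConeDesigns"]
def RankFourBounded : Prop :=
  ∃ M : ℕ, ∀ (q : ℕ) [Fact q.Prime] (N : ℕ) (a b c : Fin N → Fin 4 → ZMod q), (∀ i, a i ≠ 0 ∧ b i ≠ 0 ∧ c i ≠ 0) → Literature.Computability.AlgebraicComplexity.IsSTPP (fun i => ((Finset.univ : Finset (ZMod q)).image (fun t => t • a i)).erase 0) (fun i => ((Finset.univ : Finset (ZMod q)).image (fun t => t • b i)).erase 0) (fun i => ((Finset.univ : Finset (ZMod q)).image (fun t => t • c i)).erase 0) → N ≤ M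

/-- item stmt-MatrixMultiplication-9762 · crux · rank 4 · closed · moot by None · by planner
why it might fail: κ(6) = 1 is possible: 6-wise independent point sets of PG(5,q) are arcs of size ≤ q+1 (Ball2012, q prime), subfield/linear-set matchings of F_q^6 = F_(q^2)^3, F_(q^3)^2 collapse to N ≤ q+1 (card), and a random family of N ≫ q^(1/2) triangles has ≈ N³/q bad hexagons.
sources: Ball2012, doi:10.4171/jems/316, arXiv:1310.8522, arXiv:1904.05813, CohnKleinbergSzegedyUmans2005
[crux] FIRST GENERIC RANK, POSITIVE PROBE (card K3, recalibrated): for some δ > 0 and infinitely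
many primes q there is a cone STPP design of nonzero vectors in (ZMod q)^6 with N ≥ q^(1+δ)
triangles — beating both random alteration (q^(1/2)) and the normal rational curve (⌊(q+1)/3⌋,
support RankSixMomentCurve), hence the first design whose dependent 6-subsets systematically dodge
the labelled hexagons. [difficulty: L] -/
@[route_item "route-MatrixMultiplication-ConeDesigns"]
def RankSixSuperlinear : Prop :=
  ∃ δ : ℝ, 0 < δ ∧ ∀ q₀ : ℕ, ∃ q : ℕ, q₀ ≤ q ∧ ∃ (_ : Fact q.Prime) (N : ℕ) (a b c : Fin N → Fin 6 → ZMod q), (∀ i, a i ≠ 0 ∧ b i ≠ 0 ∧ c i ≠ 0) ∧ Literature.Computability.AlgebraicComplexity.IsSTPP (fun i => ((Finset.univ : Finset (ZMod q)).image (fun t => t • a i)).erase 0) (fun i => ((Finset.univ : Finset (ZMod q)).image (fun t => t • b i)).erase 0) (fun i => ((Finset.univ : Finset (ZMod q)).image (fun t => t • c i)).erase 0) ∧ (q : ℝ) ^ (1 + δ) ≤ (N : ℝ)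

/-- item stmt-MatrixMultiplication-9763 · support · rank 9 · closed · proved by Summit.MatrixMultiplication.MatrixMultiplication.Theorems.coneCertificate_proof (prover) · by planner
sources: CohnKleinbergSzegedyUmans2005, lean:Literature.Computability.AlgebraicComplexity.CohnKleinbergSzegedyUmans2005_5_5_abelian_holds
[support] CERTIFIED EXPONENT: for every prime q, rank n and cone STPP design of N triangles of
nonzero vectors in (ZMod q)^n, N·(q−1)^ω(ℂ) ≤ q^n — the proved abelian fundamental inequality
`CohnKleinbergSzegedyUmans2005_5_5_abelian_holds` applied to H = Fin n → ZMod q, each punctured line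
having exactly q−1 elements. [difficulty: provable-now] -/
@[route_item "route-MatrixMultiplication-ConeDesigns"]
def ConeCertificate : Prop :=
  ∀ (n q : ℕ) [Fact q.Prime] (N : ℕ) (a b c : Fin N → Fin n → ZMod q), (∀ i, a i ≠ 0 ∧ b i ≠ 0 ∧ c i ≠ 0) → Literature.Computability.AlgebraicComplexity.IsSTPP (fun i => ((Finset.univ : Finset (ZMod q)).image (fun t => t • a i)).erase 0) (fun i => ((Finset.univ : Finset (ZMod q)).image (fun t => t • b i)).erase 0) (fun i => ((Finset.univ : Finset (ZMod q)).image (fun t => t • c i)).erase 0) → (N : ℝ) * ((q : ℝ) - 1) ^ (Literature.Computability.AlgebraicComplexity.omega ℂ) ≤ (q : ℝ) ^ (n : ℝ)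

/-- item stmt-MatrixMultiplication-9764 · support · rank 9 · closed · proved by Summit.MatrixMultiplication.MatrixMultiplication.Theorems.conesBoundOmega_proof @ 141c5e4fb5a7 (prover) · by planner
sources: Blaser2013, CohnKleinbergSzegedyUmans2005
[support] PURE ANALYSIS GLUE: if for some θ > 0 there are arbitrarily large q with naturals n, N
satisfying N·(q−1)^w ≤ q^n and q^(n−2−θ) ≤ N, then w ≤ 2+θ (otherwise (1−1/q)^w·q^(w−2−θ) → ∞).
[difficulty: provable-now] -/
@[route_item "route-MatrixMultiplication-ConeDesigns"]
def ConesBoundOmega : Prop :=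
  ∀ w θ : ℝ, 0 < θ → (∀ q₀ : ℕ, ∃ q n N : ℕ, q₀ ≤ q ∧ (N : ℝ) * ((q : ℝ) - 1) ^ w ≤ (q : ℝ) ^ (n : ℝ) ∧ (q : ℝ) ^ ((n : ℝ) - 2 - θ) ≤ (N : ℝ)) → w ≤ 2 + θ

/-- item stmt-MatrixMultiplication-9765 · support · rank 9 · closed · proved by Summit.MatrixMultiplication.MatrixMultiplication.Theorems.coneCriterion_proof @ 3dc2fc9a8b94 (prover) · by planner
sources: CohnKleinbergSzegedyUmans2005, BlasiakChurchCohnGrochowNaslundSawinUmans2017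
[support] EXACT CRITERION (card P1): for a prime q ≥ 3 and nonzero vectors, the cone family is STPP
iff (i) every triangle (a_i, b_i, c_i) is linearly independent and (ii) for all (i,j,k) not all
equal no nowhere-zero λ ∈ F_q^6 has λ₀a_i + λ₁a_k + λ₂b_j + λ₃b_i + λ₄c_k + λ₅c_j = 0 (substitute s'
= λ₀a_i, s = −λ₁a_k, …; q ≥ 3 is needed only for STPP ⇒ (i)). [difficulty: provable-now] -/
@[route_item "route-MatrixMultiplication-ConeDesigns"]
def ConeCriterion : Prop :=
  ∀ (n q : ℕ) [Fact q.Prime], 3 ≤ q → ∀ (N : ℕ) (a b c : Fin N → Fin n → ZMod q), (∀ i, a i ≠ 0 ∧ b i ≠ 0 ∧ c i ≠ 0) → (Literature.Computability.AlgebraicComplexity.IsSTPP (fun i => ((Finset.univ : Finset (ZMod q)).image (fun t => t • a i)).erase 0) (fun i => ((Finset.univ : Finset (ZMod q)).image (fun t => t • b i)).erase 0) (fun i => ((Finset.univ : Finset (ZMod q)).image (fun t => t • c i)).erase 0) ↔ ((∀ i, LinearIndependent (ZMod q) ![a i, b i, c i]) ∧ ∀ i j k : Fin N, ¬ (i = j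 ∧ j = k) → ∀ l : Fin 6 → ZMod q, (∀ m, l m ≠ 0) → l 0 • a i + l 1 • a k + l 2 • b j + l 3 • b i + l 4 • c k + l 5 • c j ≠ 0))

/-- item stmt-MatrixMultiplication-9766 · support · rank 9 · closed · proved by Summit.MatrixMultiplication.MatrixMultiplication.Theorems.rankThreeAtMostTwo_proof @ 03879ea40685 (prover) · by planner
sources: CohnKleinbergSzegedyUmans2005, arXiv:math/0511460
[support] RANK THREE IS CKSU'S EXAMPLE (card Theorems 1–2): for every prime q ≥ 7 a cone STPP design
of nonzero vectors in (ZMod q)^3 has at most 2 triangles (an STPP pair is a triangle and one of its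
two cyclic relabellings; the triple Δ, ρΔ, ρ²Δ fails hexagon (0,1,2)); CKSU Prop 5.2 shows 2 is
attained. [difficulty: M] -/
@[route_item "route-MatrixMultiplication-ConeDesigns"]
def RankThreeAtMostTwo : Prop :=
  ∀ (q : ℕ) [Fact q.Prime], 7 ≤ q → ∀ (N : ℕ) (a b c : Fin N → Fin 3 → ZMod q), (∀ i, a i ≠ 0 ∧ b i ≠ 0 ∧ c i ≠ 0) → Literature.Computability.AlgebraicComplexity.IsSTPP (fun i => ((Finset.univ : Finset (ZMod q)).image (fun t => t • a i)).erase 0) (fun i => ((Finset.univ : Finset (ZMod q)).image (fun t => t • b i)).erase 0) (fun i => ((Finset.univ : Finset (ZMod q)).image (fun t => t • c i)).erase 0) → N ≤ 2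

/-- item stmt-MatrixMultiplication-9767 · support · rank 9 · closed · proved by Summit.MatrixMultiplication.MatrixMultiplication.Theorems.rankSixMomentCurve_proof @ c72aee93d46f (prover) · by planner
sources: Ball2012, CohnKleinbergSzegedyUmans2005
[support] MOMENT-CURVE BASELINE (planner's observation): for every prime q and N with 3N ≤ q there
is a cone STPP design with N triangles in (ZMod q)^6 — take 3N distinct points (1,t,…,t^5) of the
normal rational curve, any ≤ 6 of which are linearly independent (Vandermonde), and label them
arbitrarily; grouping the STPP equation by distinct vectors forces i = j = k. With CKSU Lemma 5.4
(diagonal sub-cones of products) this gives N(6k,q) ≥ ⌊q/3⌋^k. [difficulty: provable-now] -/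
@[route_item "route-MatrixMultiplication-ConeDesigns"]
def RankSixMomentCurve : Prop :=
  ∀ (q : ℕ) [Fact q.Prime] (N : ℕ), 3 * N ≤ q → ∃ (a b c : Fin N → Fin 6 → ZMod q), (∀ i, a i ≠ 0 ∧ b i ≠ 0 ∧ c i ≠ 0) ∧ Literature.Computability.AlgebraicComplexity.IsSTPP (fun i => ((Finset.univ : Finset (ZMod q)).image (fun t => t • a i)).erase 0) (fun i => ((Finset.univ : Finset (ZMod q)).image (fun t => t • b i)).erase 0) (fun i => ((Finset.univ : Finset (ZMod q)).image (fun t => t • c i)).erase 0)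

/-- item stmt-MatrixMultiplication-9768 · assembly · rank 1 · closed · proved by Summit.MatrixMultiplication.MatrixMultiplication.Theorems.coneDesigns_assembly_proof @ 802a335d2f73 (prover) · by planner
sources: CohnKleinbergSzegedyUmans2005, Blaser2013
[assembly] ConeDesignThesis → ConeCertificate → ConesBoundOmega → MatrixMultiplication (the deciding
theorem `closes` has exactly this type). -/
@[route_item "route-MatrixMultiplication-ConeDesigns"]
def Assembly : Prop :=
  ConeDesignThesis → ConeCertificate → ConesBoundOmega → MatrixMultiplication

end Summit.MatrixMultiplication.MatrixMultiplication.Theses.ConeDesigns
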